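import Summits.QuantumAdvantage.QuantumAdvantage.Theorems.WbwObfuscatedGluedTreesKowPhGameReal

/-!
# `WbwObfuscatedGluedTrees` (stmt-QuantumAdvantage-2340) — line `knowledge-of-walk-split`, STAGE 7: the ideal PRF game
# of the reduction IS the ideal-II walk game

Helper file of the PRF hybrid (stage 7) of the line `knowledge-of-walk-split`: the registered stub `stub_gameIdeal`.
For a Boolean oracle adversary `ℬ` with the walker's coins that, against EVERY oracle `O`, decides exactly whether the
walker `𝒜` wins the walk game on the ideal-II instance of the tables `tabOf μ O` read off `O`, the ideal PRF game
(`prfIdealProb`: oracle a uniformly random function `{0,1}^{μ+2} → {0,1}^μ`) has EXACTLY the ideal-II walk success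
probability (`idealWalkSuccessProb`: a uniform table quadruple `T : CodeSpace μ` and uniform coins).

The one combinatorial fact: `H ↦ tabOf μ (oracleOfTable H)` is a BIJECTION `({0,1}^{μ+2} → {0,1}^μ) ≃ CodeSpace μ`
(table `i` at `v` is `H (tkey i ++ v)`; inverse `T ↦ (z ↦ T_{keyIdx z} (z.drop 2))`), so it transports the uniform
function to a uniform table quadruple (`uniformOfFintype_map_equiv`); the rest is the counting form of a `bind` of two
uniform distributions (`toReal_uniform_bind_uniform_map_apply`).  The keyed-query lemmas `keyIdx_tkey_append`,
`drop_two_tkey_append`, `length_tkey_append_ofFn` are the sibling file's (`…KowPhGameReal`, the real game).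
[cite: Goldreich2001, Def. 3.6.4] (the ideal PRF game); [folklore] (bookkeeping).
-/

set_option linter.dupNamespace false

noncomputable section

namespace Summit.QuantumAdvantage.QuantumAdvantage.Theorems.WbwObfuscatedGluedTrees.KnowledgeOfWalk.PrfHybrid

open Literature.Computability.Complexity Literature.Computability.QuantumComplexity
open Literature.Computability.QuantumComplexity.GluedTrees
open Literature.Computability.Cryptography Literature.Computability.Cryptography.ObfuscatedGluedTrees
open Summit.QuantumAdvantage.QuantumAdvantage.Theorems.WbwObfuscatedGluedTrees.KnowledgeOfWalk.BlackBox
open Summit.QuantumAdvantage.QuantumAdvantage.Theorems.WbwObfuscatedGluedTrees.KnowledgeOfWalk.RealIdeal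
open _root_.Computability

/-! ## Keys: every `(μ + 2)`-bit string is a keyed query `tkey i ++ w` (cf. `keyIdx_tkey_append`, `drop_two_tkey_append`) -/

section Keys

variable {μ : ℕ}

/-- The table index of a string depends only on its first two bits. [folklore] -/
theorem keyIdx_cons_cons (a b : Bool) (w : List Bool) : keyIdx (a :: b :: w) = keyIdx [a, b] := rfl

/-- A 2-bit string is the key of its own index. [folklore] -/
theorem tkey_keyIdx_pair (a b : Bool) : tkey (keyIdx [a, b]) = [a, b] := by
  revert a b; decide

/-- Every string of length `μ + 2` IS a keyed query: its first two bits are `tkey (keyIdx _)`. [folklore] -/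
theorem tkey_keyIdx_append_drop {z : List Bool} (hz : z.length = μ + 2) : tkey (keyIdx z) ++ z.drop 2 = z := by
  obtain _ | ⟨a, _ | ⟨b, w⟩⟩ := z
  · rw [List.length_nil] at hz; omega
  · rw [List.length_singleton] at hz; omega
  · simp only [keyIdx_cons_cons, tkey_keyIdx_pair, List.drop_succ_cons, List.drop_zero, List.cons_append,
      List.nil_append]

end Keys

/-! ## The bijection: function tables on `μ + 2` bits ≃ table quadruples -/

section Bijection

variable {μ : ℕ}

/-- A table quadruple is determined by its four tables. [folklore] -/
theorem codeSpace_ext_tab {T T' : CodeSpace μ} (h : ∀ i, T.tab i = T'.tab i) : T = T' := by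
  have h0 := h 0; have h1 := h 1; have h2 := h 2; have h3 := h 3
  simp only [CodeSpace.tab_zero, CodeSpace.tab_one, CodeSpace.tab_two, CodeSpace.tab_three] at h0 h1 h2 h3
  exact Prod.ext (Prod.ext h0 h1) (Prod.ext h2 h3)

/-- The tables read off the oracle of a function table: table `i` at `v` is `H (tkey i ++ v)` read as a vector. [folklore] -/
theorem tabOf_oracleOfTable_tab (H : List.Vector Bool (μ + 2) → List.Vector Bool μ) (i : Fin 4) (v : Fin μ → Bool) :
    (tabOf μ (oracleOfTable H)).tab i v =
      vecOf μ (H ⟨tkey i ++ List.ofFn v, length_tkey_append_ofFn i v⟩).toList := by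
  rw [tabOf_tab, oracleOfTable_apply_of_length_eq]

/-- Reading the tables off the TABLE ORACLE of `T` — the oracle of the function table `z ↦ T_{keyIdx z}(z.drop 2)` —
gives back `T`. [folklore] -/
theorem tabOf_oracleOfTable_ofFn_tab (T : CodeSpace μ) :
    tabOf μ (oracleOfTable fun z : List.Vector Bool (μ + 2) =>
      List.Vector.ofFn (T.tab (keyIdx z.toList) (vecOf μ (z.toList.drop 2)))) = T := by
  refine codeSpace_ext_tab fun i => funext fun v => ?_
  rw [tabOf_oracleOfTable_tab]
  simp only [List.Vector.toList_ofFn, List.Vector.toList_mk, keyIdx_tkey_append, drop_two_tkey_append, vecOf_ofFn]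

/-- The function table of the tables read off the oracle of `H` is `H`. [folklore] -/
theorem ofFn_tab_tabOf_oracleOfTable (H : List.Vector Bool (μ + 2) → List.Vector Bool μ)
    (z : List.Vector Bool (μ + 2)) :
    List.Vector.ofFn ((tabOf μ (oracleOfTable H)).tab (keyIdx z.toList) (vecOf μ (z.toList.drop 2))) = H z := by
  apply List.Vector.toList_injective
  have hd : (z.toList.drop 2).length = μ := by rw [List.length_drop, List.Vector.toList_length]; omega
  rw [List.Vector.toList_ofFn, tabOf_tab, ofFn_vecOf, ofFn_vecOf, fit_of_length_eq hd,
    tkey_keyIdx_append_drop z.toList_length, oracleOfTable_toList, fit_of_length_eq (H z).toList_length]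

/-- **A uniformly random function on `μ + 2` bits, read as tables, is a uniform table quadruple**: the reading
`H ↦ tabOf μ (oracleOfTable H)` is a bijection `({0,1}^{μ+2} → {0,1}^μ) ≃ CodeSpace μ` (inverse: the function table
`z ↦ T_{keyIdx z}(z.drop 2)`), along which the uniform distribution transports. [folklore] -/
theorem uniform_map_tabOf_oracleOfTable (μ : ℕ) :
    (PMF.uniformOfFintype (List.Vector Bool (μ + 2) → List.Vector Bool μ)).map
        (fun H => tabOf μ (oracleOfTable H)) = PMF.uniformOfFintype (CodeSpace μ) :=
  uniformOfFintype_map_equiv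
    { toFun := fun H => tabOf μ (oracleOfTable H)
      invFun := fun T z => List.Vector.ofFn (T.tab (keyIdx z.toList) (vecOf μ (z.toList.drop 2)))
      left_inv := fun H => funext (ofFn_tab_tabOf_oracleOfTable H)
      right_inv := tabOf_oracleOfTable_ofFn_tab }

end Bijection

/-! ## The ideal game as a count -/

section Count

/-- **The ideal game of a table simulator, counted**: if `B` against EVERY oracle `O` (on input `⟨x, r⟩`, `|r| = c`,
within `kB` rounds) outputs exactly the bit "`A` wins the walk game on the ideal-II instance of `tabOf μ O`", then the
mass of `some true` in the ideal PRF game (uniform `H : {0,1}^{μ+2} → {0,1}^μ`, uniform coins) is the ideal-II walk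
success probability of `A`. [cite: Goldreich2001, Def. 3.6.4] -/
theorem toReal_ideal_bind_eq_idealWalkSuccessProb (μ d : ℕ) (B : OracleAlg Bool) (kB : ℕ) (A : OracleAlg (List Bool))
    (k : ℕ) (x : List Bool) (c : ℕ)
    (hsim : ∀ (O : Oracle) (r : List Bool), r.length = c →
      B.run O kB (boolPair x r) =
        some (decide (WalkWin A k (boolPair x r) (codeCycle (tabOf μ O) d) (codeNaming (tabOf μ O) d)))) :
    (((PMF.uniformOfFintype (List.Vector Bool (μ + 2) → List.Vector Bool μ)).bind fun H =>
        (PMF.uniformOfFintype (List.Vector Bool c)).map fun r =>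
          B.run (oracleOfTable H) kB (boolPair x r.toList)) (some true)).toReal =
      idealWalkSuccessProb d μ A k x c := by
  -- `B`'s run against `oracleOfTable H` depends on `H` only through the tables `tabOf μ (oracleOfTable H)`
  have hF : (fun H : List.Vector Bool (μ + 2) → List.Vector Bool μ =>
        (PMF.uniformOfFintype (List.Vector Bool c)).map fun r =>
          B.run (oracleOfTable H) kB (boolPair x r.toList)) =
      (fun T : CodeSpace μ => (PMF.uniformOfFintype (List.Vector Bool c)).map fun r =>
        some (decide (WalkWin A k (boolPair x r.toList) (codeCycle T d) (codeNaming T d)))) ∘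
        fun H => tabOf μ (oracleOfTable H) := by
    funext H
    exact congrArg (fun f => (PMF.uniformOfFintype (List.Vector Bool c)).map f)
      (funext fun r : List.Vector Bool c => hsim (oracleOfTable H) r.toList r.toList_length)
  rw [hF, ← PMF.bind_map, uniform_map_tabOf_oracleOfTable, toReal_uniform_bind_uniform_map_apply,
    idealWalkSuccessProb, Fintype.card_prod (CodeSpace μ) (List.Vector Bool c), Nat.cast_mul]
  congr 3
  refine Finset.filter_congr fun p _ => ?_
  simp only [Option.some.injEq, decide_eq_true_eq]

end Count

/-! ## The registered stub -/

/-- **Stub (the ideal game)**: for such a `ℬ`, the ideal PRF game (a uniformly random function on `μ + 2` bits) IS the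
ideal-II walk game (a uniform table quadruple). [cite: Goldreich2001, Def. 3.6.4] -/
theorem stub_gameIdeal :
    ∀ (Λ : Params) (𝒜 : OracleAdversary (List Bool)) (ℬ : OracleAdversary Bool) (n : ℕ), ℬ.coins = 𝒜.coins →
      (∀ (O : Oracle) (r : List Bool), r.length = 𝒜.coins.eval (gameInput n).length →
          ℬ.alg.run O (ℬ.fuel.eval (gameInput n).length) (boolPair (gameInput n) r) =
            some (decide (WalkWin 𝒜.alg (𝒜.fuel.eval (gameInput n).length) (boolPair (gameInput n) r)
              (codeCycle (tabOf (Λ.prfParam n) O) (Λ.depth n)) (codeNaming (tabOf (Λ.prfParam n) O) (Λ.depth n))))) →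
      prfIdealProb (fun n => Λ.prfParam n + 2) Λ.prfParam ℬ n =
        idealWalkSuccessProb (Λ.depth n) (Λ.prfParam n) 𝒜.alg (𝒜.fuel.eval (gameInput n).length) (gameInput n)
          (𝒜.coins.eval (gameInput n).length) := by
  intro Λ 𝒜 ℬ n hcoins hsim
  obtain ⟨Balg, Bcoins, Bfuel⟩ := ℬ
  change Bcoins = 𝒜.coins at hcoins
  subst hcoins
  exact toReal_ideal_bind_eq_idealWalkSuccessProb (Λ.prfParam n) (Λ.depth n) Balg
    (Bfuel.eval (gameInput n).length) 𝒜.alg (𝒜.fuel.eval (gameInput n).length) (gameInput n)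
    (𝒜.coins.eval (gameInput n).length) hsim

end Summit.QuantumAdvantage.QuantumAdvantage.Theorems.WbwObfuscatedGluedTrees.KnowledgeOfWalk.PrfHybrid

end
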